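import Summits.QuantumAdvantage.QuantumAdvantage.Theorems.LivenessSeparationLaw
import Summits.QuantumAdvantage.QuantumAdvantage.Theorems.CharDialSegmentMovesA

set_option linter.dupNamespace false

/-!
# LIVENESS SEPARATION, part N (lens 4, g28 cycle 4d) — LIVENESS DESIGN (Lemma D of NODE-g28 §5g, kernel)

Blocker `X = AbsorptionDial.NoPerfectPolyOdd` (item 28487).  The walk exponent at a cut `g` is `walkExp u g = wt u + wtPrefix u g` (a one at position
`i < g` weighs 2, a one at `i ≥ g` weighs 1), and cut `g` is live at `u` iff `c + g + walkExp u g ≢ 0 (mod 3)`.  Hence ONE extra one placed in the gap after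
cut `j` raises the exponent of every cut `≤` that position by 1 and of every later cut by 2: the liveness residues of a chain of cuts are DESIGNABLE gap by gap.
`gapDesign` places `x₀` ones before the first cut and `x j ≤ 2` ones right after cut `j` (2-separation makes room); `walkExp_gapDesign` computes every cut's
exponent in closed form; `gapDesign_dead` / `gapDesign_live` turn prescribed residues into liveness; ★ `livenessDesign` (existence): for 2-separated cuts
`g 0 < … < g (T-1) ≤ n`, `2 ≤ n`, not the ends pair `{0, n}` with `n ≡ c`, some input makes ONE chosen-by-the-lemma cut live and all the others dead.
(Part O restates it for a `Finset` of cuts and in the block form consumed by part M `loss_of_designedClassRectangle`; together they are the game side of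
«SeparatedQuadNoPerfectOdd», NODE §5g CLAIM S.)
-/

open Finset
open Summit.QuantumAdvantage.AdviceFreeQNC0
open Summit.QuantumAdvantage.QuantumAdvantage.Theorems.InnerDegreeDial

namespace Summit.QuantumAdvantage.QuantumAdvantage.Theorems.LivenessSeparation

variable {n : ℕ}

/-! ### walk exponent bookkeeping -/

/-- moving the cut from `a` to `b ≥ a` raises the walk exponent by the number of ones in `[a, b)` -/
theorem walkExp_eq_add_card (u : Fin n → Bool) {a b : ℕ} (hab : a ≤ b) :
    walkExp u b = walkExp u a + (univ.filter fun i : Fin n => a ≤ i.val ∧ i.val < b ∧ u i = true).card := by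
  unfold walkExp wtPrefix
  have hsplit : (univ.filter fun i : Fin n => i.val < b ∧ u i = true)
      = (univ.filter fun i : Fin n => i.val < a ∧ u i = true) ∪
        (univ.filter fun i : Fin n => a ≤ i.val ∧ i.val < b ∧ u i = true) := by
    ext i
    simp only [mem_filter, mem_univ, true_and, mem_union]
    constructor
    · rintro ⟨h1, h2⟩
      by_cases h : i.val < a
      · exact Or.inl ⟨h, h2⟩
      · exact Or.inr ⟨by omega, h1, h2⟩
    · rintro (⟨h1, h2⟩ | ⟨h1, h2, h3⟩)
      · exact ⟨by omega, h2⟩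
      · exact ⟨h2, h3⟩
  rw [hsplit, card_union_of_disjoint]
  · ring
  · rw [disjoint_left]
    intro i h1 h2
    rw [mem_filter] at h1 h2
    omega

/-! ### the gap design -/

/-- `x₀` ones before the first cut, `x j` ones right after cut `j` (`j < T`) -/
def gapDesign (n T : ℕ) (g : ℕ → ℕ) (x₀ : ℕ) (x : ℕ → ℕ) : Fin n → Bool :=
  fun i => decide (i.val < x₀ ∨ ∃ j < T, g j ≤ i.val ∧ i.val < g j + x j)

section Design

variable {T : ℕ} {g : ℕ → ℕ} {x₀ : ℕ} {x : ℕ → ℕ}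

/-- 2-separated cuts are monotone with gaps `≥ 2` -/
theorem gap_le_of_sep (hsep : ∀ j, j + 1 < T → g j + 2 ≤ g (j + 1)) {j j' : ℕ} (hjj : j < j') (hj' : j' < T) :
    g j + 2 ≤ g j' := by
  induction j' with
  | zero => omega
  | succ k ih =>
    rcases Nat.lt_succ_iff_lt_or_eq.mp hjj with h | h
    · exact le_trans (by linarith [ih h (by omega)]) (hsep k hj')
    · subst h
      exact hsep j hj'

/-- monotonicity -/
theorem le_of_sep (hsep : ∀ j, j + 1 < T → g j + 2 ≤ g (j + 1)) {j j' : ℕ} (hjj : j ≤ j') (hj' : j' < T) :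
    g j ≤ g j' := by
  rcases Nat.lt_or_eq_of_le hjj with h | h
  · linarith [gap_le_of_sep hsep h hj']
  · rw [h]

/-- inside the gap after cut `l` the design is the initial segment of length `x l` -/
theorem gapDesign_mem_gap (hsep : ∀ j, j + 1 < T → g j + 2 ≤ g (j + 1)) (hx₀ : x₀ ≤ g 0) (hx : ∀ j < T, x j ≤ 2)
    {l : ℕ} (hl : l < T) (i : Fin n) (h1 : g l ≤ i.val) (h2 : l + 1 < T → i.val < g (l + 1)) :
    gapDesign n T g x₀ x i = true ↔ i.val < g l + x l := by
  unfold gapDesign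
  rw [decide_eq_true_iff]
  constructor
  · rintro (h | ⟨j, hj, hj1, hj2⟩)
    · have := le_of_sep hsep (Nat.zero_le l) hl
      omega
    · rcases lt_trichotomy j l with hjl | hjl | hjl
      · have := gap_le_of_sep hsep hjl hl
        have := hx j hj
        omega
      · subst hjl
        exact hj2
      · have h3 := h2 (by omega)
        have := le_of_sep hsep (show l + 1 ≤ j by omega) hj
        omega
  · intro h
    exact Or.inr ⟨l, hl, h1, h⟩

/-- before the first cut the design is the initial segment of length `x₀` -/
theorem gapDesign_mem_head (hsep : ∀ j, j + 1 < T → g j + 2 ≤ g (j + 1)) (i : Fin n) (h2 : i.val < g 0) :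
    gapDesign n T g x₀ x i = true ↔ i.val < x₀ := by
  unfold gapDesign
  rw [decide_eq_true_iff]
  constructor
  · rintro (h | ⟨j, hj, hj1, hj2⟩)
    · exact h
    · have := le_of_sep hsep (Nat.zero_le j) hj
      omega
  · exact Or.inl

/-- ones of the design in the gap after cut `l` (up to the next cut, or to `n` after the last cut) : `x l` -/
theorem card_gapDesign_gap (hsep : ∀ j, j + 1 < T → g j + 2 ≤ g (j + 1)) (hgn : g (T - 1) ≤ n) (hx₀ : x₀ ≤ g 0)
    (hx : ∀ j < T, x j ≤ 2) (hxn : g (T - 1) + x (T - 1) ≤ n) {l : ℕ} (hl : l < T) (b : ℕ)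
    (hb : b = if l + 1 < T then g (l + 1) else n) :
    (univ.filter fun i : Fin n => g l ≤ i.val ∧ i.val < b ∧ gapDesign n T g x₀ x i = true).card = x l := by
  have hlb : g l + x l ≤ b := by
    rw [hb]
    split_ifs with h
    · have := hsep l h
      have := hx l hl
      omega
    · have : l = T - 1 := by omega
      subst this
      exact hxn
  have hbn : b ≤ n := by
    rw [hb]
    split_ifs with h
    · exact le_trans (le_of_sep hsep (show l + 1 ≤ T - 1 by omega) (by omega)) hgn
    · exact le_rfl
  have e : (univ.filter fun i : Fin n => g l ≤ i.val ∧ i.val < b ∧ gapDesign n T g x₀ x i = true)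
      = univ.filter fun i : Fin n => g l ≤ i.val ∧ i.val < g l + x l := by
    refine filter_congr fun i _ => ?_
    constructor
    · rintro ⟨h1, h2, h3⟩
      have h4 : l + 1 < T → i.val < g (l + 1) := fun h => by rw [hb, if_pos h] at h2; exact h2
      exact ⟨h1, (gapDesign_mem_gap hsep hx₀ hx hl i h1 h4).mp h3⟩
    · rintro ⟨h1, h2⟩
      have h4 : l + 1 < T → i.val < g (l + 1) := fun h => by
        have := hsep l h
        have := hx l hl
        omega
      exact ⟨h1, by omega, (gapDesign_mem_gap hsep hx₀ hx hl i h1 h4).mpr h2⟩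
  rw [e, Summit.QuantumAdvantage.AdviceFreeQNC0.JLinPeel.SegMove.card_window (by omega)]
  omega

/-- ones of the design before the first cut: `x₀` -/
theorem card_gapDesign_head (hsep : ∀ j, j + 1 < T → g j + 2 ≤ g (j + 1)) (hT : 1 ≤ T) (hgn : g (T - 1) ≤ n) (hx₀ : x₀ ≤ g 0) :
    (univ.filter fun i : Fin n => i.val < g 0 ∧ gapDesign n T g x₀ x i = true).card = x₀ := by
  have h0n : g 0 ≤ n := le_trans (le_of_sep hsep (Nat.zero_le _) (by omega)) hgn
  have e : (univ.filter fun i : Fin n => i.val < g 0 ∧ gapDesign n T g x₀ x i = true)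
      = univ.filter fun i : Fin n => 0 ≤ i.val ∧ i.val < x₀ := by
    refine filter_congr fun i _ => ?_
    constructor
    · rintro ⟨h1, h2⟩
      exact ⟨Nat.zero_le _, (gapDesign_mem_head hsep i h1).mp h2⟩
    · rintro ⟨-, h2⟩
      exact ⟨by omega, (gapDesign_mem_head hsep i (by omega)).mpr h2⟩
  rw [e, Summit.QuantumAdvantage.AdviceFreeQNC0.JLinPeel.SegMove.card_window (by omega)]
  omega

/-- prefix weight of the design at cut `l`: `x₀ + Σ_{j<l} x j` -/
theorem wtPrefix_gapDesign (hsep : ∀ j, j + 1 < T → g j + 2 ≤ g (j + 1)) (hT : 1 ≤ T) (hgn : g (T - 1) ≤ n) (hx₀ : x₀ ≤ g 0)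
    (hx : ∀ j < T, x j ≤ 2) (hxn : g (T - 1) + x (T - 1) ≤ n) {l : ℕ} (hl : l < T) :
    wtPrefix (gapDesign n T g x₀ x) (g l) = x₀ + ∑ j ∈ range l, x j := by
  induction l with
  | zero =>
    rw [sum_range_zero, add_zero]
    exact card_gapDesign_head hsep hT hgn hx₀
  | succ k ih =>
    have hk : k < T := by omega
    have h1 := walkExp_eq_add_card (gapDesign n T g x₀ x) (le_of_sep hsep (show k ≤ k + 1 by omega) hl)
    unfold walkExp at h1
    rw [ih hk, card_gapDesign_gap hsep hgn hx₀ hx hxn hk (g (k + 1)) (by rw [if_pos hl])] at h1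
    rw [sum_range_succ]
    omega

/-- weight of the design: `x₀ + Σ_{j<T} x j` -/
theorem wt_gapDesign (hsep : ∀ j, j + 1 < T → g j + 2 ≤ g (j + 1)) (hT : 1 ≤ T) (hgn : g (T - 1) ≤ n) (hx₀ : x₀ ≤ g 0)
    (hx : ∀ j < T, x j ≤ 2) (hxn : g (T - 1) + x (T - 1) ≤ n) :
    wt (gapDesign n T g x₀ x) = x₀ + ∑ j ∈ range T, x j := by
  have h1 := walkExp_eq_add_card (gapDesign n T g x₀ x) hgn
  unfold walkExp at h1
  rw [Summit.QuantumAdvantage.AdviceFreeQNC0.ConstBells.wtPrefix_self, wtPrefix_gapDesign hsep hT hgn hx₀ hx hxn (show T - 1 < T by omega),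
    card_gapDesign_gap hsep hgn hx₀ hx hxn (show T - 1 < T by omega) n (by rw [if_neg (by omega)])] at h1
  obtain ⟨T', rfl⟩ : ∃ T', T = T' + 1 := ⟨T - 1, by omega⟩
  rw [sum_range_succ]
  simp only [Nat.add_sub_cancel] at h1 ⊢
  omega

/-- walk exponent of the design at cut `l`, closed form -/
theorem walkExp_gapDesign (hsep : ∀ j, j + 1 < T → g j + 2 ≤ g (j + 1)) (hT : 1 ≤ T) (hgn : g (T - 1) ≤ n) (hx₀ : x₀ ≤ g 0)
    (hx : ∀ j < T, x j ≤ 2) (hxn : g (T - 1) + x (T - 1) ≤ n) {l : ℕ} (hl : l < T) :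
    walkExp (gapDesign n T g x₀ x) (g l) = (x₀ + ∑ j ∈ range T, x j) + (x₀ + ∑ j ∈ range l, x j) := by
  unfold walkExp
  rw [wt_gapDesign hsep hT hgn hx₀ hx hxn, wtPrefix_gapDesign hsep hT hgn hx₀ hx hxn hl]

end Design

/-! ### residue design -/

section Residues

variable {T : ℕ} {g : ℕ → ℕ}

/-- residue targets: `r` at cut `j₀`, `0` at every other cut -/
def tgt (j₀ r j : ℕ) : ℕ := if j = j₀ then r else 0

/-- targets are residues -/
theorem tgt_le {j₀ r : ℕ} (hr : r ≤ 2) (j : ℕ) : tgt j₀ r j ≤ 2 := by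
  unfold tgt
  split_ifs <;> omega

/-- the gap fillings realising the targets: `x j ≡ R (j+1) - R j - (g (j+1) - g j)` between cuts, `xl` after the last cut -/
def xDesign (T : ℕ) (g : ℕ → ℕ) (j₀ r xl j : ℕ) : ℕ :=
  if j + 1 < T then (tgt j₀ r (j + 1) + (3 - tgt j₀ r j) + (3 - (g (j + 1) - g j) % 3)) % 3 else xl

/-- fillings are at most 2 -/
theorem xDesign_le {j₀ r xl : ℕ} (hxl : xl ≤ 2) (j : ℕ) : xDesign T g j₀ r xl j ≤ 2 := by
  unfold xDesign
  split_ifs <;> omega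

/-- the last filling -/
theorem xDesign_last {j₀ r xl j : ℕ} (hj : j + 1 = T) : xDesign T g j₀ r xl j = xl := by
  unfold xDesign
  rw [if_neg (by omega)]

/-- the designed residues: `g l + Σ_{j<l} x j ≡ g 0 + R l - R 0 (mod 3)` -/
theorem residue_xDesign (hsep : ∀ j, j + 1 < T → g j + 2 ≤ g (j + 1)) {j₀ r xl : ℕ} (hr : r ≤ 2) {l : ℕ} (hl : l < T) :
    (g l + ∑ j ∈ range l, xDesign T g j₀ r xl j) % 3 = (g 0 + tgt j₀ r l + (3 - tgt j₀ r 0)) % 3 := by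
  induction l with
  | zero =>
    have := tgt_le (j₀ := j₀) hr 0
    rw [sum_range_zero]
    omega
  | succ k ih =>
    have hk : k < T := by omega
    have h1 := ih hk
    have h2 : xDesign T g j₀ r xl k = (tgt j₀ r (k + 1) + (3 - tgt j₀ r k) + (3 - (g (k + 1) - g k) % 3)) % 3 := by
      unfold xDesign
      rw [if_pos hl]
    have h3 := hsep k hl
    have h4 := tgt_le (j₀ := j₀) hr k
    have h5 := tgt_le (j₀ := j₀) hr (k + 1)
    have h6 := tgt_le (j₀ := j₀) hr 0
    rw [sum_range_succ, h2]
    omega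

/-- THE WALK RESIDUES OF THE DESIGN: with `x₀ ≤ min 2 (g 0)` ones before the first cut, `xl ≤ min 2 (n - g (T-1))` after the last one and the
congruence `(★)`, cut `l` has walk residue `c + g l + walkExp ≡ R l`. -/
theorem walk_residue_gapDesign (hsep : ∀ j, j + 1 < T → g j + 2 ≤ g (j + 1)) (hT : 1 ≤ T) (hgn : g (T - 1) ≤ n)
    {c j₀ r x₀ xl : ℕ} (hr : r ≤ 2) (hx₀ : x₀ ≤ g 0) (hxl2 : xl ≤ 2) (hxln : g (T - 1) + xl ≤ n)
    (hstar : (c + 2 * x₀ + xl + 2 * g 0 + 2 * g (T - 1) + tgt j₀ r (T - 1) + 2 * (3 - tgt j₀ r 0)) % 3 = 0)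
    {l : ℕ} (hl : l < T) :
    (c + g l + walkExp (gapDesign n T g x₀ (xDesign T g j₀ r xl)) (g l)) % 3 = tgt j₀ r l % 3 := by
  obtain ⟨T', rfl⟩ : ∃ T', T = T' + 1 := ⟨T - 1, by omega⟩
  have hx : ∀ j < T' + 1, xDesign (T' + 1) g j₀ r xl j ≤ 2 := fun j _ => xDesign_le hxl2 j
  have hxn : g (T' + 1 - 1) + xDesign (T' + 1) g j₀ r xl (T' + 1 - 1) ≤ n := by
    rw [Nat.add_sub_cancel, xDesign_last rfl]
    simpa using hxln
  rw [walkExp_gapDesign hsep hT hgn hx₀ hx hxn hl, sum_range_succ, xDesign_last rfl]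
  have r1 := residue_xDesign hsep (j₀ := j₀) (xl := xl) hr hl
  have r2 := residue_xDesign hsep (j₀ := j₀) (xl := xl) hr (show T' < T' + 1 by omega)
  simp only [Nat.add_sub_cancel] at hstar
  have h4 := tgt_le (j₀ := j₀) hr l
  have h5 := tgt_le (j₀ := j₀) hr T'
  have h6 := tgt_le (j₀ := j₀) hr 0
  omega

/-- the designed live cut -/
theorem gapDesign_live (hsep : ∀ j, j + 1 < T → g j + 2 ≤ g (j + 1)) (hT : 1 ≤ T) (hgn : g (T - 1) ≤ n)
    {c j₀ r x₀ xl : ℕ} (hr : r = 1 ∨ r = 2) (hx₀ : x₀ ≤ g 0) (hxl2 : xl ≤ 2) (hxln : g (T - 1) + xl ≤ n)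
    (hstar : (c + 2 * x₀ + xl + 2 * g 0 + 2 * g (T - 1) + tgt j₀ r (T - 1) + 2 * (3 - tgt j₀ r 0)) % 3 = 0)
    (hj₀ : j₀ < T) (gl : Fin (n + 1)) (hgl : gl.val = g j₀) :
    liveCut c (gapDesign n T g x₀ (xDesign T g j₀ r xl)) gl = true := by
  have h := walk_residue_gapDesign (n := n) hsep hT hgn (c := c) (j₀ := j₀) (x₀ := x₀) (by omega : r ≤ 2) hx₀ hxl2 hxln hstar hj₀
  rw [tgt, if_pos rfl] at h
  unfold liveCut
  rw [hgl, decide_eq_true_eq]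
  omega

/-- the designed dead cuts -/
theorem gapDesign_dead (hsep : ∀ j, j + 1 < T → g j + 2 ≤ g (j + 1)) (hT : 1 ≤ T) (hgn : g (T - 1) ≤ n)
    {c j₀ r x₀ xl : ℕ} (hr : r = 1 ∨ r = 2) (hx₀ : x₀ ≤ g 0) (hxl2 : xl ≤ 2) (hxln : g (T - 1) + xl ≤ n)
    (hstar : (c + 2 * x₀ + xl + 2 * g 0 + 2 * g (T - 1) + tgt j₀ r (T - 1) + 2 * (3 - tgt j₀ r 0)) % 3 = 0)
    {l : ℕ} (hl : l < T) (hlj : l ≠ j₀) (gl : Fin (n + 1)) (hgl : gl.val = g l) :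
    liveCut c (gapDesign n T g x₀ (xDesign T g j₀ r xl)) gl = false := by
  have h := walk_residue_gapDesign (n := n) hsep hT hgn (c := c) (j₀ := j₀) (x₀ := x₀) (by omega : r ≤ 2) hx₀ hxl2 hxln hstar hl
  rw [tgt, if_neg hlj] at h
  unfold liveCut
  rw [hgl, decide_eq_false_iff_not]
  omega

/-- packaging: any admissible `(j₀, r, x₀, xl)` gives a liveness design -/
theorem livenessDesign_of (hsep : ∀ j, j + 1 < T → g j + 2 ≤ g (j + 1)) (hT : 1 ≤ T) (hgn : g (T - 1) ≤ n)
    {c j₀ r x₀ xl : ℕ} (hj₀ : j₀ < T) (hr : r = 1 ∨ r = 2) (hx₀ : x₀ ≤ g 0) (hxl2 : xl ≤ 2) (hxln : g (T - 1) + xl ≤ n)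
    (hstar : (c + 2 * x₀ + xl + 2 * g 0 + 2 * g (T - 1) + tgt j₀ r (T - 1) + 2 * (3 - tgt j₀ r 0)) % 3 = 0) :
    ∃ u : Fin n → Bool, ∃ j₀ < T, (∀ gl : Fin (n + 1), gl.val = g j₀ → liveCut c u gl = true) ∧
      ∀ l < T, l ≠ j₀ → ∀ gl : Fin (n + 1), gl.val = g l → liveCut c u gl = false :=
  ⟨gapDesign n T g x₀ (xDesign T g j₀ r xl), j₀, hj₀, fun gl hgl => gapDesign_live hsep hT hgn hr hx₀ hxl2 hxln hstar hj₀ gl hgl,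
    fun _ hl hlj gl hgl => gapDesign_dead hsep hT hgn hr hx₀ hxl2 hxln hstar hl hlj gl hgl⟩

/-- **LIVENESS DESIGN (Lemma D of NODE-g28 §5g).**  `T ≥ 1` cuts `g 0 < g 1 < ⋯ < g (T-1) ≤ n`, consecutive ones at distance `≥ 2`, on a board of
length `n ≥ 2`, NOT the ends pair `{0, n}` with `n ≡ c (mod 3)`: some input makes one of the cuts live and all the others dead. -/
theorem livenessDesign (c : ℕ) (hsep : ∀ j, j + 1 < T → g j + 2 ≤ g (j + 1)) (hT : 1 ≤ T) (hgn : g (T - 1) ≤ n) (hn : 2 ≤ n)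
    (hends : ¬ (T = 2 ∧ g 0 = 0 ∧ g 1 = n ∧ n % 3 = c % 3)) :
    ∃ u : Fin n → Bool, ∃ j₀ < T, (∀ gl : Fin (n + 1), gl.val = g j₀ → liveCut c u gl = true) ∧
      ∀ l < T, l ≠ j₀ → ∀ gl : Fin (n + 1), gl.val = g l → liveCut c u gl = false := by
  have h0 : g 0 ≤ g (T - 1) := le_of_sep hsep (Nat.zero_le _) (by omega)
  by_cases hT1 : T = 1
  · -- one cut
    subst hT1
    simp only [Nat.sub_self] at hgn h0 ⊢
    by_cases hE : (c + 2 * g 0 + 2 * g 0) % 3 = 0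
    · by_cases hb : g 0 + 1 ≤ n
      · refine livenessDesign_of hsep le_rfl (by simpa using hgn) (j₀ := 0) (r := 1) (x₀ := 0) (xl := 1) (by omega) (Or.inl rfl)
          (Nat.zero_le _) (by omega) (by simpa using hb) ?_
        simp only [Nat.sub_self, tgt, ite_true]
        omega
      · refine livenessDesign_of hsep le_rfl (by simpa using hgn) (j₀ := 0) (r := 2) (x₀ := 1) (xl := 0) (by omega) (Or.inr rfl)
          (by omega) (by omega) (by simpa using hgn) ?_
        simp only [Nat.sub_self, tgt, ite_true]
        omega
    · refine livenessDesign_of hsep le_rfl (by simpa using hgn) (j₀ := 0) (r := (c + 2 * g 0 + 2 * g 0) % 3) (x₀ := 0) (xl := 0)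
        (by omega) (by omega) (Nat.zero_le _) (by omega) (by simpa using hgn) ?_
      simp only [Nat.sub_self, tgt, ite_true]
      omega
  · have h01 : g 0 + 2 ≤ g (T - 1) := gap_le_of_sep hsep (show 0 < T - 1 by omega) (by omega)
    by_cases hE : (c + 2 * g 0 + 2 * g (T - 1)) % 3 = 0
    · by_cases hT3 : 3 ≤ T
      · -- a middle cut is live
        refine livenessDesign_of hsep hT hgn (j₀ := 1) (r := 1) (x₀ := 0) (xl := 0) (by omega) (Or.inl rfl) (Nat.zero_le _)
          (by omega) (by simpa using hgn) ?_
        rw [tgt, if_neg (by omega), tgt, if_neg (by omega)]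
        omega
      · have hT2 : T = 2 := by omega
        subst hT2
        simp only [show 2 - 1 = 1 from rfl] at hgn h0 h01 hE ⊢
        by_cases hb : g 1 + 1 ≤ n
        · refine livenessDesign_of hsep hT (by simpa using hgn) (j₀ := 0) (r := 2) (x₀ := 0) (xl := 1) (by omega) (Or.inr rfl)
            (Nat.zero_le _) (by omega) (by simpa using hb) ?_
          simp only [show 2 - 1 = 1 from rfl, tgt, ite_true, one_ne_zero, ite_false]
          omega
        · by_cases ha : 1 ≤ g 0
          · refine livenessDesign_of hsep hT (by simpa using hgn) (j₀ := 0) (r := 1) (x₀ := 1) (xl := 0) (by omega) (Or.inl rfl)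
              ha (by omega) (by simpa using hgn) ?_
            simp only [show 2 - 1 = 1 from rfl, tgt, ite_true, one_ne_zero, ite_false]
            omega
          · exfalso
            exact hends ⟨rfl, by omega, by omega, by omega⟩
    · -- the first cut is live
      refine livenessDesign_of hsep hT hgn (j₀ := 0) (r := 3 - (c + 2 * g 0 + 2 * g (T - 1)) % 3) (x₀ := 0) (xl := 0) (by omega)
        (by omega) (Nat.zero_le _) (by omega) (by simpa using hgn) ?_
      rw [tgt, if_neg (by omega), tgt, if_pos rfl]
      omega

end Residues

end Summit.QuantumAdvantage.QuantumAdvantage.Theorems.LivenessSeparation
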